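/-
Origin: expansion seat `planner-pub-hodgecm-pv15-g2-0`, handover #2 2026-08-18T06:11:47Z (`HOME/pub-hodgecm-pv15-g2/lean/Pv15g2/BumpApprox.lean`, md5 34fa2bc0, 160 lines);
landed by the gen-6 packager in gate run 24 as `HodgeCM/Automorphic/BumpApprox.lean` (verbatim).
-/
/-
Origin: HOME/pub-hodgecm-pv15-g2/lean/Pv15g2/BumpApprox.lean — session planner-pub-hodgecm-pv15-g2-0
(unit pub-hodgecm-pv15-g2, DAG-NODE PROVER #15 gen 2; lineage N23a / AX12).
Intended final place (packager's call): `HodgeCM/Automorphic/BumpApprox.lean`.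
NEW, ADDITIVE; touches no existing file.  Imports the landed `HodgeCM.PerL34.Vanishing` (Urysohn bumps) only.

KIND: KERNEL, Mathlib generality (nothing cited, nothing posited).
Relation to the landed gen-1 `HodgeCM.PerL34.ApproxIdentity` (pv06; `smOp`, Dirac SEQUENCES for `F = (R · v)`, first
countable `G`) and pv06-g3's run-24 `CompactApprox` (`norm_smOp_sub_le`): this is the POINTWISE form for an arbitrary
continuous `F : X → E` on a locally compact Hausdorff SPACE, one bump at a time (no sequence, no first countability),
which is what the torus-side consumer needs (`F h = ϑ_{T,χ}(ω(h)Φ)` is not an orbit map of a representation).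
Different namespace (`HodgeCM.BumpApprox`), no name clash.
-/
import Summits.HodgeConjecture.HodgeCM.PerL34.Vanishing

set_option autoImplicit false

/-!
# Approximate identities: `∫ φ • F dμ → F(x₀)` as the bump `φ` concentrates at `x₀`

The analytic content of PerL v5's "approximate-identity limit" (Thm 3.7, tex ll. 453–455: every generator
`ϑ_{T,χ}(Φ)` is the `L²`-limit of `𝒯_Φ(E^χ_{f_n}) = ∫ f_n(h) ϑ_{T,χ}(ω(h)Φ) dh` for an approximate identity `f_n`,
"Step 1 and continuity of `h ↦ ϑ_{T,χ}(ω(h)Φ)`") and of the Dirac-sequence step `R(f_n)v → v` of the discrete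
decomposition (Getz–Hahn §9.3), proved ONCE in Mathlib generality:

* `norm_integral_smul_sub_le` — the estimate: `0 ≤ φ`, `∫ φ dμ = 1`, `‖F x − F x₀‖ ≤ ε` on the support of `φ`
  ⟹ `‖∫ φ • F dμ − F x₀‖ ≤ ε`;
* `exists_bump_norm_integral_smul_sub_lt` — on a locally compact Hausdorff space with a measure finite on compacts
  and positive on opens, for `F` continuous at... (we assume `F` continuous) and every `ε > 0` and every open `U ∋ x₀`
  there is a continuous compactly supported `φ ≥ 0`, `∫ φ = 1`, supported in `U`, with `‖∫ φ • F − F x₀‖ < ε`;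
* `mem_closure_range_integral_smul` — hence `F x₀ ∈ closure {∫ f • F dμ : f ∈ C_c(X, ℂ)}` (complex test
  functions, the form the carrier's `AX12_molly` consumes).
-/

noncomputable section

open MeasureTheory Set Filter CompactlySupported
open scoped Topology

namespace HodgeCM
namespace BumpApprox

section Estimate

variable {X : Type*} [MeasurableSpace X] (μ : Measure X)
variable {E : Type*} [NormedAddCommGroup E] [NormedSpace ℝ E] [CompleteSpace E]

/-- **The approximate-identity estimate.**  If `φ ≥ 0` has total mass one and `F` is within `ε` of `F x₀` on the
support of `φ`, then `∫ φ • F dμ` is within `ε` of `F x₀`. -/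
theorem norm_integral_smul_sub_le {φ : X → ℝ} {F : X → E} {x₀ : X} {ε : ℝ}
    (hφi : Integrable φ μ) (hφF : Integrable (fun x => φ x • F x) μ) (hφ0 : ∀ x, 0 ≤ φ x)
    (hφ1 : ∫ x, φ x ∂μ = 1) (hε : ∀ x ∈ Function.support φ, ‖F x - F x₀‖ ≤ ε) :
    ‖∫ x, φ x • F x ∂μ - F x₀‖ ≤ ε := by
  have h1 : ∫ x, φ x • F x ∂μ - F x₀ = ∫ x, φ x • (F x - F x₀) ∂μ := by
    simp_rw [smul_sub]
    rw [integral_sub hφF (hφi.smul_const _), integral_smul_const, hφ1, one_smul]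
  rw [h1]
  calc ‖∫ x, φ x • (F x - F x₀) ∂μ‖ ≤ ∫ x, φ x * ε ∂μ := by
        refine norm_integral_le_of_norm_le (hφi.mul_const ε) (Eventually.of_forall fun x => ?_)
        rw [norm_smul, Real.norm_of_nonneg (hφ0 x)]
        by_cases hx : φ x = 0
        · simp [hx]
        · exact mul_le_mul_of_nonneg_left (hε x hx) (hφ0 x)
    _ = ε := by rw [integral_mul_const, hφ1, one_mul]

end Estimate

section Bump

variable {X : Type*} [TopologicalSpace X] [LocallyCompactSpace X] [T2Space X] [MeasurableSpace X]
  [OpensMeasurableSpace X] (μ : Measure X) [IsFiniteMeasureOnCompacts μ] [μ.IsOpenPosMeasure]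
variable {E : Type*} [NormedAddCommGroup E] [NormedSpace ℝ E] [CompleteSpace E]

/-- **Normalised bumps exist**: in every open neighbourhood `U` of `x₀` there is a continuous compactly supported
`φ ≥ 0` with `∫ φ dμ = 1` (the measure is positive on opens and finite on compacts). -/
theorem exists_normalised_bump (x₀ : X) {U : Set X} (hU : IsOpen U) (hxU : x₀ ∈ U) :
    ∃ φ : X → ℝ, Continuous φ ∧ HasCompactSupport φ ∧ (∀ x, 0 ≤ φ x) ∧ ∫ x, φ x ∂μ = 1 ∧
      Function.support φ ⊆ U := by
  obtain ⟨ψ, hψc, hψs, hψ0, hψ1, hψU⟩ := PerL34.Vanishing.exists_bump_subset x₀ hU hxU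
  have hpos : 0 < ∫ x, ψ x ∂μ :=
    hψc.integral_pos_of_hasCompactSupport_nonneg_nonzero hψs (fun x => hψ0 x) (by rw [hψ1]; exact one_ne_zero)
  set c := ∫ x, ψ x ∂μ with hc
  refine ⟨fun x => ψ x / c, hψc.div_const c, ?_, fun x => div_nonneg (hψ0 x) hpos.le, ?_, ?_⟩
  · refine hψs.mono fun x hx => ?_
    have hx' : ψ x / c ≠ 0 := hx
    intro h
    exact hx' (by simp [h])
  · rw [integral_div, div_self hpos.ne']
  · intro x hx
    refine hψU ?_
    simp only [Function.mem_support, ne_eq] at hx ⊢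
    intro h
    exact hx (by simp [h])

/-- **The approximate-identity limit, `ε`-form.**  For `F` continuous, `x₀ ∈ U` open and `ε > 0` there is a
normalised bump `φ` supported in `U` with `‖∫ φ • F dμ − F x₀‖ < ε`. -/
theorem exists_bump_norm_integral_smul_sub_lt {F : X → E} (hF : Continuous F) (x₀ : X)
    {U : Set X} (hU : IsOpen U) (hxU : x₀ ∈ U) {ε : ℝ} (hε : 0 < ε) :
    ∃ φ : X → ℝ, Continuous φ ∧ HasCompactSupport φ ∧ (∀ x, 0 ≤ φ x) ∧ ∫ x, φ x ∂μ = 1 ∧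
      Function.support φ ⊆ U ∧ ‖∫ x, φ x • F x ∂μ - F x₀‖ < ε := by
  set V : Set X := U ∩ F ⁻¹' Metric.ball (F x₀) (ε / 2) with hV
  have hVo : IsOpen V := hU.inter (Metric.isOpen_ball.preimage hF)
  have hxV : x₀ ∈ V := ⟨hxU, by simp [hε]⟩
  obtain ⟨φ, hφc, hφs, hφ0, hφ1, hφV⟩ := exists_normalised_bump μ x₀ hVo hxV
  refine ⟨φ, hφc, hφs, hφ0, hφ1, hφV.trans inter_subset_left, ?_⟩
  have hφi : Integrable φ μ := hφc.integrable_of_hasCompactSupport hφs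
  have hφF : Integrable (fun x => φ x • F x) μ :=
    (hφc.smul hF).integrable_of_hasCompactSupport (hφs.smul_right (f' := F))
  have hle : ‖∫ x, φ x • F x ∂μ - F x₀‖ ≤ ε / 2 := by
    refine norm_integral_smul_sub_le μ hφi hφF hφ0 hφ1 fun x hx => ?_
    have hx' := (hφV hx).2
    rw [mem_preimage, Metric.mem_ball, dist_eq_norm] at hx'
    exact hx'.le
  linarith

end Bump

section BumpCc

variable {X : Type*} [TopologicalSpace X]

/-- The complex test function attached to a real bump. -/
def bumpCc {φ : X → ℝ} (hφc : Continuous φ) (hφs : HasCompactSupport φ) : C_c(X, ℂ) where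
  toFun x := (φ x : ℂ)
  continuous_toFun := Complex.continuous_ofReal.comp hφc
  hasCompactSupport' := hφs.comp_left Complex.ofReal_zero

/-- (Ported verbatim from the HodgeCMPerL package; no docstring in the source.) -/
@[simp] theorem bumpCc_apply {φ : X → ℝ} (hφc : Continuous φ) (hφs : HasCompactSupport φ) (x : X) :
    bumpCc hφc hφs x = (φ x : ℂ) := rfl

end BumpCc

section Complex

variable {X : Type*} [TopologicalSpace X] [LocallyCompactSpace X] [T2Space X] [MeasurableSpace X]
  [OpensMeasurableSpace X] (μ : Measure X) [IsFiniteMeasureOnCompacts μ] [μ.IsOpenPosMeasure]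
variable {E : Type*} [NormedAddCommGroup E] [NormedSpace ℂ E] [CompleteSpace E]

/-- **The approximate-identity limit, closure form** (what `AX12_molly` consumes): for `F : X → E` continuous into
a complex Banach space, `F x₀` lies in the closure of `{∫ f • F dμ : f ∈ C_c(X, ℂ)}`. -/
theorem mem_closure_range_integral_smul {F : X → E} (hF : Continuous F) (x₀ : X) :
    F x₀ ∈ closure (Set.range fun f : C_c(X, ℂ) => ∫ x, (f x : ℂ) • F x ∂μ) := by
  rw [Metric.mem_closure_iff]
  intro ε hε
  obtain ⟨φ, hφc, hφs, hφ0, hφ1, -, hlt⟩ :=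
    exists_bump_norm_integral_smul_sub_lt μ hF x₀ isOpen_univ (mem_univ x₀) hε
  refine ⟨_, ⟨bumpCc hφc hφs, rfl⟩, ?_⟩
  have h : (∫ x, (bumpCc hφc hφs x : ℂ) • F x ∂μ) = ∫ x, φ x • F x ∂μ := by
    simp only [bumpCc_apply, Complex.coe_smul]
  rw [dist_comm, dist_eq_norm]
  show ‖(∫ x, (bumpCc hφc hφs x : ℂ) • F x ∂μ) - F x₀‖ < ε
  rw [h]
  exact hlt

end Complex

end BumpApprox
end HodgeCM

end
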